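import Summits.BirchSwinnertonDyer.BirchSwinnertonDyer.Theorems.PrintCf2SplitBadRubinValueTwoAnchorsFiveTen
import Summits.BirchSwinnertonDyer.BirchSwinnertonDyer.Theorems.PrintCf2SplitBadRubinValueTwoAnchorsSixSixtyTwo
import Summits.BirchSwinnertonDyer.BirchSwinnertonDyer.Theorems.PrintCf2SplitBadRubinValueTwoAnchorsOfPrint
import HarnessLib

set_option linter.dupNamespace false
set_option autoImplicit false

/-!
# Crux `PrintCf2.SplitBadTwoRankOneOfFacts` (stmt-BirchSwinnertonDyer-20368), road α = line `rubin_value_two` (v5 `d1eb21d31f9bc683` /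
# v7, LEAD g9), stub S4b `stub_anchor_two_kit` — the PRINT-LIGHT NUMERIC ALTERNATIVE: the registered S4b body VERBATIM from
# (i) four anchor data, and from (ii) SIX prints + FOUR `2`-adic unit certificates of `#Ш_an`

Cell `bsd-print-cf2`, width seat `bsd-line-cf2-p1-w4` g5 (`--supports stmt-BirchSwinnertonDyer-20368`). HONEST FRAMING: bookkeeping over the
two kernel anchor files (`…AnchorsFiveTen` — -w3 g3, keys (1,3)/(0,3), anchors `−5`/`−10`; `…AnchorsSixSixtyTwo` — this seat, p645619, keys
(0,5)/(0,1), anchors `−6`/`−62`); every theorem is CONDITIONAL on its displayed binders; no BSD statement is proved; BSD is not proved by any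
of this and no summit statement is proved by this seat. Theses-free.

CONTEXT. LEAD g9 (2026-08-28T15:36Z) made S4b FACTS-RELATIVE over cell bsd-goldfeld's FOURTEEN prints (skeleton v7, stub
`stub_anchor_two_ofPrint`, landed by -w3 g4 in `…AnchorsOfPrint`: CST14 Thm 1.1, CLTZ15 Thm 1.2/4.4/1.4, Creutz–Miller, Modularity,
Burungale–Tian, Burungale–Flach, Gross–Zagier, Kolyvagin, GZK, the Manin certificate of `X₀(49)`, Ligozat's `η`-quotient, Deuring's
factorisation — the last two flagged «derived-from-print» for the referee). This file records the OTHER discharge, with a different dependency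
profile, should the referee object to some of the fourteen: S4b ⟸ SIX prints {Kriz–Li 2019 Thm 1.20, Modularity, CLTZ15 Thm 1.2,
Gross–Zagier, Heegner rationality, GZK} + FOUR NUMERIC CERTIFICATES `∃ q : ℚ, #Ш_an(W₀) = q ∧ ord₂ q = 0` on the explicit global minimal
models `E₋₅ = [0,−105,0,2800,0]`, `E₋₆ = [0,−126,0,4032,0]`, `E₋₁₀ = [0,−210,0,11200,0]`, `E₋₆₂ = [0,−1302,0,430528,0]` (all four of
Mordell–Weil rank EXACTLY `1` with `Ш[2] = 0` UNCONDITIONALLY — part (a), kernel), i.e. four Miller-style evaluations of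
`#Ш_an = L′(E,1)·#E(ℚ)²_tors/(Ω·Reg·∏c_ℓ)` to 2-adic-unit precision at conductors `19600, 28224, 78400, 3013696` (kit; not done here):
* `anchor_two_kit_of_anchorData`: S4b VERBATIM ⟸ the four data `r_an(W₀) = 1 ∧ BSD(W₀,2)` (print-free bookkeeping, key split = -w3 g4's
  `key_cases`; anchor `−6` for key (0,5) instead of `−38`);
* `anchor_two_kit_of_shaAn_units`: S4b VERBATIM ⟸ the six prints + the four unit certificates (part (b) shapes: `r_an = 1` BY NAME via
  bsd-goldfeld's Bernoulli certificates, `Ш[2^∞] = 0`, `BSD(W₀,2) ⟺ ord₂ #Ш_an(W₀) = 0`).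

References: [Miller2011LMS] Def. 1.1, Thm. 1.2; [KrizLi2019] Thm. 1.20; [SilvermanAEC2009] VIII.6.7, X.4.2(a).
-/

noncomputable section

open scoped Classical

open WeierstrassCurve Literature.NumberTheory.EllipticCurves Literature.NumberTheory.EllipticCurves.ModularForms
  Literature.NumberTheory.EllipticCurves.KrizLi2019
  Summit.BirchSwinnertonDyer.BirchSwinnertonDyer.Theorems.GoldfeldGoodTwists

namespace Summit.BirchSwinnertonDyer.BirchSwinnertonDyer.Theorems.PrintCf2.RubinValueTwoAnchor

/-! ## §1 S4b from the four anchor data (pure bookkeeping over the landed part (a) files) -/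

/-- **S4b ⟸ FOUR ANCHOR DATA.** If each of the four anchor curves `E₋₅ = [0,−105,0,2800,0]` (key (1,3)), `E₋₆ = [0,−126,0,4032,0]`
(key (0,5)), `E₋₁₀ = [0,−210,0,11200,0]` (key (0,3)), `E₋₆₂ = [0,−1302,0,430528,0]` (key (0,1)) has analytic rank `1` and
satisfies `BSD(·,2)`, then the registered stub `stub_anchor_two_kit` (S4b of line `rubin_value_two` v5, crux
stmt-BirchSwinnertonDyer-20368) holds VERBATIM: every admissible `d` off the in-tree keys has an anchor of its own 2-adic key.
Global minimality and the twist identities are the kernel theorems of part (a) (`anchor_neg_{five,ten}_partA` of -w3 g3,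
`anchor_neg_{six,sixtytwo}_partA` of p645619); only `r_an = 1 ∧ BSD(W₀,2)` is taken as data; the key split is -w3 g4's `key_cases`.
(Twin of -w3 g4's `stub_anchor_two_kit_of_anchors`, which is parametrised by the anchors `−5, −10, −38, −62` and any models.)
[cite: Miller2011LMS, Def. 1.1] -/
theorem anchor_two_kit_of_anchorData
    (hA5 : haveI := isElliptic_twoTorsionModel_neg_five
      (⟨0, -105, 0, 2800, 0⟩ : WeierstrassCurve ℚ).analyticRank = 1 ∧ BSDp (⟨0, -105, 0, 2800, 0⟩ : WeierstrassCurve ℚ) 2)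
    (hA6 : haveI := isElliptic_E6
      (⟨0, -126, 0, 4032, 0⟩ : WeierstrassCurve ℚ).analyticRank = 1 ∧ BSDp (⟨0, -126, 0, 4032, 0⟩ : WeierstrassCurve ℚ) 2)
    (hA10 : haveI := isElliptic_twoTorsionModel_neg_ten
      (⟨0, -210, 0, 11200, 0⟩ : WeierstrassCurve ℚ).analyticRank = 1 ∧ BSDp (⟨0, -210, 0, 11200, 0⟩ : WeierstrassCurve ℚ) 2)
    (hA62 : haveI := isElliptic_E62
      (⟨0, -1302, 0, 430528, 0⟩ : WeierstrassCurve ℚ).analyticRank = 1 ∧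
        BSDp (⟨0, -1302, 0, 430528, 0⟩ : WeierstrassCurve ℚ) 2) :
    ∀ (d : ℤ), d ≠ 0 → Squarefree d → d % 4 ≠ 1 → (d / (2 - d % 2)) % 8 ≠ 7 →
    ∃ (d₀ : ℤ) (W₀ : WeierstrassCurve ℚ) (_ : W₀.IsElliptic) (_ : W₀.IsGloballyMinimal)
      (C₀ : VariableChange ℚ),
      d₀ ≠ 0 ∧ Squarefree d₀ ∧ d₀ % 4 ≠ 1 ∧ d₀ % 2 = d % 2 ∧ (d₀ / (2 - d₀ % 2)) % 8 = (d / (2 - d % 2)) % 8 ∧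
      C₀ • W₀ = cm7.quadraticTwist (d₀ : ℚ) ∧ W₀.analyticRank = 1 ∧ BSDp W₀ 2 := by
  intro d _hd0 hsq hd4 hk7
  rcases key_cases hsq hd4 hk7 with ⟨hpar, hk⟩ | ⟨hpar, hk | hk | hk⟩
  · -- key (1,3): anchor `d₀ = −5`
    obtain ⟨C₀, hC₀⟩ := exists_smul_E5_eq_cm7_quadraticTwist_neg_five
    exact ⟨-5, ⟨0, -105, 0, 2800, 0⟩, isElliptic_twoTorsionModel_neg_five, isGloballyMinimal_E5, C₀, by decide,
      Int.squarefree_natAbs.mp (by norm_num [Nat.prime_five.squarefree]), by decide, by rw [hpar]; decide, by rw [hk]; decide,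
      hC₀, hA5.1, hA5.2⟩
  · -- key (0,1): anchor `d₀ = −62`
    obtain ⟨C₀, hC₀⟩ := exists_smul_E62_eq_cm7_quadraticTwist_neg_sixtytwo
    refine ⟨-62, ⟨0, -1302, 0, 430528, 0⟩, isElliptic_E62, isGloballyMinimal_E62, C₀, by decide,
      ?_, by decide, by rw [hpar]; decide, by rw [hk]; decide, hC₀, hA62.1, hA62.2⟩
    refine Int.squarefree_natAbs.mp ?_
    rw [show (-62 : ℤ).natAbs = 2 * 31 by norm_num, Nat.squarefree_mul_iff]
    exact ⟨by norm_num, Nat.prime_two.squarefree, (by norm_num : Nat.Prime 31).squarefree⟩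
  · -- key (0,3): anchor `d₀ = −10`
    obtain ⟨C₀, hC₀⟩ := exists_smul_E10_eq_cm7_quadraticTwist_neg_ten
    refine ⟨-10, ⟨0, -210, 0, 11200, 0⟩, isElliptic_twoTorsionModel_neg_ten, isGloballyMinimal_E10, C₀, by decide,
      ?_, by decide, by rw [hpar]; decide, by rw [hk]; decide, hC₀, hA10.1, hA10.2⟩
    refine Int.squarefree_natAbs.mp ?_
    rw [show (-10 : ℤ).natAbs = 2 * 5 by norm_num, Nat.squarefree_mul_iff]
    exact ⟨by norm_num, Nat.prime_two.squarefree, Nat.prime_five.squarefree⟩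
  · -- key (0,5): anchor `d₀ = −6`
    obtain ⟨C₀, hC₀⟩ := exists_smul_E6_eq_cm7_quadraticTwist_neg_six
    refine ⟨-6, ⟨0, -126, 0, 4032, 0⟩, isElliptic_E6, isGloballyMinimal_E6, C₀, by decide,
      ?_, by decide, by rw [hpar]; decide, by rw [hk]; decide, hC₀, hA6.1, hA6.2⟩
    refine Int.squarefree_natAbs.mp ?_
    rw [show (-6 : ℤ).natAbs = 2 * 3 by norm_num, Nat.squarefree_mul_iff]
    exact ⟨by norm_num, Nat.prime_two.squarefree, Nat.prime_three.squarefree⟩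

/-! ## §2 S4b from six prints and four `2`-adic unit certificates of `#Ш_an` -/

/-- **S4b ⟸ PRINTS + FOUR NUMERIC CERTIFICATES.** Granted Kriz–Li 2019 Thm. 1.20, Modularity, CLTZ 2015 Thm. 1.2, Gross–Zagier, Heegner
rationality (these give `r_an(W₀) = 1` for the four anchors BY NAME, bsd-goldfeld's Bernoulli certificates) and GZK (rank, finiteness),
the registered stub `stub_anchor_two_kit` follows from the four `2`-ADIC UNIT CERTIFICATES `∃ q : ℚ, #Ш_an(W₀) = q ∧ ord₂ q = 0`,
`W₀ ∈ {E₋₅, E₋₆, E₋₁₀, E₋₆₂}` — the part (b) shapes turn each into `BSD(W₀,2)` (`Ш[2^∞] = 0` by the complete 2-descents). This is the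
exact residue of S4b: four Miller-style numerical evaluations of `#Ш_an = L′(E,1)·#tors²/(Ω·Reg·∏c_ℓ)` to 2-adic unit precision
(conductors `19600`, `28224`, `78400`, `3013696`), nothing else. [cite: Miller2011LMS, Def. 1.1, Thm. 1.2] [cite: KrizLi2019, Thm. 1.20 (pp. 7–8)] -/
theorem anchor_two_kit_of_shaAn_units (h120 : thm120_padicLogHeegner_unit_of_bernoulli)
    (hnf : exists_isNewformOf) (h12 : CoatesLiTianZhai2015.thm12_fullBSD_twist)
    (hGZ : ∀ (N : ℕ) [NeZero N] (W : WeierstrassCurve ℚ) (K : Type) [Field K] [NumberField K], gross_zagier N W K)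
    (hHP : ∀ (W : WeierstrassCurve ℚ) (K : Type) [Field K] [NumberField K], exists_isHeegnerPoint W K)
    (hGZK : rank_eq_analyticRank_of_analyticRank_le_one)
    (hc5 : haveI := isElliptic_twoTorsionModel_neg_five
      ∃ q : ℚ, shaAn (⟨0, -105, 0, 2800, 0⟩ : WeierstrassCurve ℚ) = (q : ℂ) ∧ padicValRat 2 q = 0)
    (hc6 : haveI := isElliptic_E6
      ∃ q : ℚ, shaAn (⟨0, -126, 0, 4032, 0⟩ : WeierstrassCurve ℚ) = (q : ℂ) ∧ padicValRat 2 q = 0)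
    (hc10 : haveI := isElliptic_twoTorsionModel_neg_ten
      ∃ q : ℚ, shaAn (⟨0, -210, 0, 11200, 0⟩ : WeierstrassCurve ℚ) = (q : ℂ) ∧ padicValRat 2 q = 0)
    (hc62 : haveI := isElliptic_E62
      ∃ q : ℚ, shaAn (⟨0, -1302, 0, 430528, 0⟩ : WeierstrassCurve ℚ) = (q : ℂ) ∧ padicValRat 2 q = 0) :
    ∀ (d : ℤ), d ≠ 0 → Squarefree d → d % 4 ≠ 1 → (d / (2 - d % 2)) % 8 ≠ 7 →
    ∃ (d₀ : ℤ) (W₀ : WeierstrassCurve ℚ) (_ : W₀.IsElliptic) (_ : W₀.IsGloballyMinimal)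
      (C₀ : VariableChange ℚ),
      d₀ ≠ 0 ∧ Squarefree d₀ ∧ d₀ % 4 ≠ 1 ∧ d₀ % 2 = d % 2 ∧ (d₀ / (2 - d₀ % 2)) % 8 = (d / (2 - d % 2)) % 8 ∧
      C₀ • W₀ = cm7.quadraticTwist (d₀ : ℚ) ∧ W₀.analyticRank = 1 ∧ BSDp W₀ 2 := by
  obtain ⟨h5r, -, -, h5i⟩ := anchor_neg_five_partB_shape h120 hnf h12 hGZ hHP hGZK
  obtain ⟨h6r, -, -, h6i⟩ := anchor_neg_six_partB_shape h120 hnf h12 hGZ hHP hGZK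
  obtain ⟨h10r, -, -, h10i⟩ := anchor_neg_ten_partB_shape h120 hnf h12 hGZ hHP hGZK
  obtain ⟨h62r, -, -, h62i⟩ := anchor_neg_sixtytwo_partB_shape h120 hnf h12 hGZ hHP hGZK
  exact anchor_two_kit_of_anchorData ⟨h5r, h5i.mpr hc5⟩ ⟨h6r, h6i.mpr hc6⟩ ⟨h10r, h10i.mpr hc10⟩ ⟨h62r, h62i.mpr hc62⟩

end Summit.BirchSwinnertonDyer.BirchSwinnertonDyer.Theorems.PrintCf2.RubinValueTwoAnchor

end
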